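import Summits.AtomisticToContinuum.HydrodynamicLimit.Theses.ZenoDiameterTransfer

/-!
# Birth skeleton — piece X3 `TwinTiltLimit` of the decomposition of `DiluteEntropicTwin`
(stmt-AtomisticToContinuum-12207; crux-strategist, 2026-08-17)

Three stubs and the composition `TwinTiltLimit_of` (sorry-free; sorries only in the stubs):
* `stub_vitali_lite` — the abstract step over VARYING probability spaces: `L²`-bounded + convergence in
  probability ⇒ convergence of expectations (Cauchy–Schwarz on the deviation event; elementary);
* `stub_tilt_inProbability` — the tilt functional at time `s` converges in probability under the twin law to
  `𝓗(s)`: finite combination of the three field limits delivered by `TendstoHydroFieldsAt` (continuous test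
  functions `log ρ' − 3/2 log(2πθ') − |u'|²/(2θ')`, `u'_k/θ'`, `1/θ'`) and the pointwise algebra
  `χ₁ρ' + Σ_k χ₂ₖρ'u'_k − χ₃E' = ρ'(log ρ' − 3/2 log(2πθ') − 3/2)`;
* `stub_tilt_L2bound` — uniform-in-`N` second moment of the tilt under the time-`s` twin law (|Λ_s| ≤ a + b·KE
  per particle; energy conservation on good orbits `IsHardSphereTrajectory.configEnergy_eq_holds`; Gaussian
  fourth moments at time 0 `integral_energy_sq_gaussMeasure_le`), with the integrability facts and the
  probability of the push-forward law.
-/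

namespace Summit.AtomisticToContinuum.HydrodynamicLimit.Cruxes.DiluteEntropicTwin.TwinTiltLimit

set_option linter.dupNamespace false

open scoped BigOperators Topology ENNReal
open Filter Set MeasureTheory

/-- The piece (verbatim the staged sub-item `TwinTiltLimit`). -/
def TwinTiltLimit : Prop :=
  ∀ (T' : ℝ) (ρ' θ' : ℝ → Literature.MathematicalPhysics.KineticTheory.T3 → ℝ) (u' : ℝ → Literature.MathematicalPhysics.KineticTheory.T3 → Literature.MathematicalPhysics.KineticTheory.V3), Literature.MathematicalPhysics.KineticTheory.IsHardSphereEulerSolution 0 T' ρ' u' θ' → ∀ ε' : ℕ → ℝ, (∀ N : ℕ, 0 < ε' N ∧ ε' N < 2⁻¹) → ∀ Φ' : (N : ℕ) → Literature.Analysis.FluidPDE.HardSphereFlow (Literature.Analysis.FluidPDE.Torus.geometry (Fin 3)) (ε' N) (N + 1), (∀ N : ℕ, MeasureTheory.IsProbabilityMeasure (Literature.Analysis.FluidPDE.particleLaw (Φ' N) (Literature.Analysis.FluidPDE.canonicalDensity (Literature.Analysis.FluidPDE.Torus.geometry (Fin 3)) (ε' N) (N + 1) (Literature.MathematicalPhysics.KineticTheory.localGibbsProfile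 (ρ' 0) (u' 0) (θ' 0))))) → ∀ s ∈ Set.Ico 0 T', Literature.MathematicalPhysics.KineticTheory.TendstoHydroFieldsAt (fun N => (Literature.Analysis.FluidPDE.particleLaw (Φ' N) (Literature.Analysis.FluidPDE.canonicalDensity (Literature.Analysis.FluidPDE.Torus.geometry (Fin 3)) (ε' N) (N + 1) (Literature.MathematicalPhysics.KineticTheory.localGibbsProfile (ρ' 0) (u' 0) (θ' 0))))) Φ' ρ' u' θ' s → Filter.Tendsto (fun N : ℕ => (∫ z, (Literature.MathematicalPhysics.KineticTheory.empiricalDensityField z (fun x => Real.log (ρ' s x) - 3 / 2 * Real.log (2 * Real.pi * θ' s x) - ‖u' s x‖ ^ 2 / (2 * θ' s x)) + (∑ k : Fin 3, Literature.MathematicalPhysics.KineticTheory.empiricalMomentumField z (fun x => (u' s x) k / θ' s x) k) - Literature.MathematicalPhysics.KineticTheory.empiricalEnergyField z (fun x => (θ' s x)⁻¹)) ∂((Φ' N).lawAt (Literature.Analysis.FluidPDE.particleLaw (Φ' N) (Literature.Analysis.FluidPDE.canonicalDensity (Literature.Analysis.FluidPDE.Torus.geometry (Fin 3)) (ε' N)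 (N + 1) (Literature.MathematicalPhysics.KineticTheory.localGibbsProfile (ρ' 0) (u' 0) (θ' 0)))) s))) Filter.atTop (nhds (∫ x, ρ' s x * (Real.log (ρ' s x) - 3 / 2 * Real.log (2 * Real.pi * θ' s x) - 3 / 2)))

/-- Stub 1 — `L²`-bounded convergence in probability moves expectations (varying probability spaces). -/
theorem stub_vitali_lite :
    ∀ (Ω : ℕ → Type) [∀ N, MeasurableSpace (Ω N)] (μ : ∀ N, MeasureTheory.Measure (Ω N)) (X : ∀ N, Ω N → ℝ) (a C : ℝ), (∀ N, MeasureTheory.IsProbabilityMeasure (μ N)) → (∀ N, MeasureTheory.Integrable (X N) (μ N)) → (∀ N, MeasureTheory.Integrable (fun ω => (X N ω - a) ^ 2) (μ N)) → (∀ N, ∫ ω, (X N ω - a) ^ 2 ∂(μ N) ≤ C) → (∀ δ > (0 : ℝ), Filter.Tendsto (fun N => μ N {ω | δ < |X N ω - a|}) Filter.atTop (nhds 0)) → Filter.Tendsto (fun N => ∫ ω, X N ω ∂(μ N)) Filter.atTop (nhds a) := by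
  sorry

/-- Stub 2 — the tilt converges in probability to `𝓗(s)` under the twin law at time `s`. -/
theorem stub_tilt_inProbability :
    ∀ (T' : ℝ) (ρ' θ' : ℝ → Literature.MathematicalPhysics.KineticTheory.T3 → ℝ) (u' : ℝ → Literature.MathematicalPhysics.KineticTheory.T3 → Literature.MathematicalPhysics.KineticTheory.V3), Literature.MathematicalPhysics.KineticTheory.IsHardSphereEulerSolution 0 T' ρ' u' θ' → ∀ ε' : ℕ → ℝ, (∀ N : ℕ, 0 < ε' N ∧ ε' N < 2⁻¹) → ∀ Φ' : (N : ℕ) → Literature.Analysis.FluidPDE.HardSphereFlow (Literature.Analysis.FluidPDE.Torus.geometry (Fin 3)) (ε' N) (N + 1), (∀ N : ℕ, MeasureTheory.IsProbabilityMeasure (Literature.Analysis.FluidPDE.particleLaw (Φ' N) (Literature.Analysis.FluidPDE.canonicalDensity (Literature.Analysis.FluidPDE.Torus.geometry (Fin 3)) (ε' N) (N + 1) (Literature.MathematicalPhysics.KineticTheory.localGibbsProfile (ρ' 0) (u' 0) (θ' 0))))) → ∀ s ∈ Set.Ico 0 T', Literature.MathematicalPhysics.KineticTheory.TendstoHydroFieldsAt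 (fun N => (Literature.Analysis.FluidPDE.particleLaw (Φ' N) (Literature.Analysis.FluidPDE.canonicalDensity (Literature.Analysis.FluidPDE.Torus.geometry (Fin 3)) (ε' N) (N + 1) (Literature.MathematicalPhysics.KineticTheory.localGibbsProfile (ρ' 0) (u' 0) (θ' 0))))) Φ' ρ' u' θ' s → ∀ δ > (0 : ℝ), Filter.Tendsto (fun N : ℕ => ((Φ' N).lawAt (Literature.Analysis.FluidPDE.particleLaw (Φ' N) (Literature.Analysis.FluidPDE.canonicalDensity (Literature.Analysis.FluidPDE.Torus.geometry (Fin 3)) (ε' N) (N + 1) (Literature.MathematicalPhysics.KineticTheory.localGibbsProfile (ρ' 0) (u' 0) (θ' 0)))) s) {z | δ < |(Literature.MathematicalPhysics.KineticTheory.empiricalDensityField z (fun x => Real.log (ρ' s x) - 3 / 2 * Real.log (2 * Real.pi * θ' s x) - ‖u' s x‖ ^ 2 / (2 * θ' s x)) + (∑ k : Fin 3, Literature.MathematicalPhysics.KineticTheory.empiricalMomentumField z (fun x => (u' s x) k / θ' s x) k) - Literature.MathematicalPhysics.KineticTheory.empiricalEnergyField z (fun x => (θ' s x)⁻¹)) -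 (∫ x, ρ' s x * (Real.log (ρ' s x) - 3 / 2 * Real.log (2 * Real.pi * θ' s x) - 3 / 2))|}) Filter.atTop (nhds 0) := by
  sorry

/-- Stub 3 — uniform second-moment bound (energy conservation + Gaussian moments). -/
theorem stub_tilt_L2bound :
    ∀ (T' : ℝ) (ρ' θ' : ℝ → Literature.MathematicalPhysics.KineticTheory.T3 → ℝ) (u' : ℝ → Literature.MathematicalPhysics.KineticTheory.T3 → Literature.MathematicalPhysics.KineticTheory.V3), Literature.MathematicalPhysics.KineticTheory.IsHardSphereEulerSolution 0 T' ρ' u' θ' → ∀ ε' : ℕ → ℝ, (∀ N : ℕ, 0 < ε' N ∧ ε' N < 2⁻¹) → ∀ Φ' : (N : ℕ) → Literature.Analysis.FluidPDE.HardSphereFlow (Literature.Analysis.FluidPDE.Torus.geometry (Fin 3)) (ε' N) (N + 1), (∀ N : ℕ, MeasureTheory.IsProbabilityMeasure (Literature.Analysis.FluidPDE.particleLaw (Φ' N) (Literature.Analysis.FluidPDE.canonicalDensity (Literature.Analysis.FluidPDE.Torus.geometry (Fin 3)) (ε' N) (N + 1) (Literature.MathematicalPhysics.KineticTheory.localGibbsProfile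 (ρ' 0) (u' 0) (θ' 0))))) → ∀ s ∈ Set.Ico 0 T', ∃ C : ℝ, ∀ N : ℕ, MeasureTheory.IsProbabilityMeasure ((Φ' N).lawAt (Literature.Analysis.FluidPDE.particleLaw (Φ' N) (Literature.Analysis.FluidPDE.canonicalDensity (Literature.Analysis.FluidPDE.Torus.geometry (Fin 3)) (ε' N) (N + 1) (Literature.MathematicalPhysics.KineticTheory.localGibbsProfile (ρ' 0) (u' 0) (θ' 0)))) s) ∧ MeasureTheory.Integrable (fun z : Literature.Analysis.FluidPDE.Config (N + 1) (Fin 3) Literature.MathematicalPhysics.KineticTheory.T3 => (Literature.MathematicalPhysics.KineticTheory.empiricalDensityField z (fun x => Real.log (ρ' s x) - 3 / 2 * Real.log (2 * Real.pi * θ' s x) - ‖u' s x‖ ^ 2 / (2 * θ' s x)) + (∑ k : Fin 3, Literature.MathematicalPhysics.KineticTheory.empiricalMomentumField z (fun x => (u' s x) k / θ' s x) k) - Literature.MathematicalPhysics.KineticTheory.empiricalEnergyField z (fun x => (θ' s x)⁻¹))) ((Φ' N).lawAt (Literature.Analysis.FluidPDE.particleLaw (Φ' N) (Literature.Analysis.FluidPDE.canonicalDensity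 (Literature.Analysis.FluidPDE.Torus.geometry (Fin 3)) (ε' N) (N + 1) (Literature.MathematicalPhysics.KineticTheory.localGibbsProfile (ρ' 0) (u' 0) (θ' 0)))) s) ∧ MeasureTheory.Integrable (fun z : Literature.Analysis.FluidPDE.Config (N + 1) (Fin 3) Literature.MathematicalPhysics.KineticTheory.T3 => ((Literature.MathematicalPhysics.KineticTheory.empiricalDensityField z (fun x => Real.log (ρ' s x) - 3 / 2 * Real.log (2 * Real.pi * θ' s x) - ‖u' s x‖ ^ 2 / (2 * θ' s x)) + (∑ k : Fin 3, Literature.MathematicalPhysics.KineticTheory.empiricalMomentumField z (fun x => (u' s x) k / θ' s x) k) - Literature.MathematicalPhysics.KineticTheory.empiricalEnergyField z (fun x => (θ' s x)⁻¹)) - (∫ x, ρ' s x * (Real.log (ρ' s x) - 3 / 2 * Real.log (2 * Real.pi * θ' s x) - 3 / 2))) ^ 2) ((Φ' N).lawAt (Literature.Analysis.FluidPDE.particleLaw (Φ' N) (Literature.Analysis.FluidPDE.canonicalDensity (Literature.Analysis.FluidPDE.Torus.geometry (Fin 3)) (ε' N) (N + 1) (Literature.MathematicalPhysics.KineticTheory.localGibbsProfile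 (ρ' 0) (u' 0) (θ' 0)))) s) ∧ (∫ z, ((Literature.MathematicalPhysics.KineticTheory.empiricalDensityField z (fun x => Real.log (ρ' s x) - 3 / 2 * Real.log (2 * Real.pi * θ' s x) - ‖u' s x‖ ^ 2 / (2 * θ' s x)) + (∑ k : Fin 3, Literature.MathematicalPhysics.KineticTheory.empiricalMomentumField z (fun x => (u' s x) k / θ' s x) k) - Literature.MathematicalPhysics.KineticTheory.empiricalEnergyField z (fun x => (θ' s x)⁻¹)) - (∫ x, ρ' s x * (Real.log (ρ' s x) - 3 / 2 * Real.log (2 * Real.pi * θ' s x) - 3 / 2))) ^ 2 ∂((Φ' N).lawAt (Literature.Analysis.FluidPDE.particleLaw (Φ' N) (Literature.Analysis.FluidPDE.canonicalDensity (Literature.Analysis.FluidPDE.Torus.geometry (Fin 3)) (ε' N) (N + 1) (Literature.MathematicalPhysics.KineticTheory.localGibbsProfile (ρ' 0) (u' 0) (θ' 0)))) s)) ≤ C := by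
  sorry

/-- **Composition** (kernel-checked). -/
theorem TwinTiltLimit_of : TwinTiltLimit := by
  have hS1 := stub_vitali_lite
  have hS2 := stub_tilt_inProbability
  have hS3 := stub_tilt_L2bound
  intro T' ρ' θ' u' hE ε' hε' Φ' hprob s hs hfields
  obtain ⟨C, hC⟩ := hS3 T' ρ' θ' u' hE ε' hε' Φ' hprob s hs
  exact hS1 (fun N => Literature.Analysis.FluidPDE.Config (N + 1) (Fin 3) Literature.MathematicalPhysics.KineticTheory.T3) (fun N => ((Φ' N).lawAt (Literature.Analysis.FluidPDE.particleLaw (Φ' N) (Literature.Analysis.FluidPDE.canonicalDensity (Literature.Analysis.FluidPDE.Torus.geometry (Fin 3)) (ε' N) (N + 1) (Literature.MathematicalPhysics.KineticTheory.localGibbsProfile (ρ' 0) (u' 0) (θ' 0)))) s))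
    (fun N => fun z : Literature.Analysis.FluidPDE.Config (N + 1) (Fin 3) Literature.MathematicalPhysics.KineticTheory.T3 => (Literature.MathematicalPhysics.KineticTheory.empiricalDensityField z (fun x => Real.log (ρ' s x) - 3 / 2 * Real.log (2 * Real.pi * θ' s x) - ‖u' s x‖ ^ 2 / (2 * θ' s x)) + (∑ k : Fin 3, Literature.MathematicalPhysics.KineticTheory.empiricalMomentumField z (fun x => (u' s x) k / θ' s x) k) - Literature.MathematicalPhysics.KineticTheory.empiricalEnergyField z (fun x => (θ' s x)⁻¹))) (∫ x, ρ' s x * (Real.log (ρ' s x) - 3 / 2 * Real.log (2 * Real.pi * θ' s x) - 3 / 2)) C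
    (fun N => (hC N).1) (fun N => (hC N).2.1) (fun N => (hC N).2.2.1) (fun N => (hC N).2.2.2)
    (hS2 T' ρ' θ' u' hE ε' hε' Φ' hprob s hs hfields)

end Summit.AtomisticToContinuum.HydrodynamicLimit.Cruxes.DiluteEntropicTwin.TwinTiltLimit
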